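import Literature.NumberTheory.Automorphic.RestrictedTensorProductAdmissibleProofs
import Literature.NumberTheory.Automorphic.RestrictedProductBoxes
import HarnessLib

/-!
# Box-level invariants of a restricted tensor product: `(⊗'ᵢ Vᵢ)^{∏ Lᵢ} ≅ ⊗_{i ∈ S} Vᵢ^{Lᵢ}`

Topic `NumberTheory/Automorphic`; namespace `Literature.NumberTheory.Automorphic`.  Let `(W, π, j)` be a restricted tensor
product `π ≅ ⊗'_i (ρ i, x₀ i)` of representations of a restricted product `Πʳ i, [G i, K i]` (★ `IsRestrictedTensorProductRep
ρ π hx₀ j S₀`, [Flath1979 §2 Example 2; Bump1997 §3.4]) over a field `k`, let `S ⊇ S₀` be a finite set of indices and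
`L i ≤ G i` a family of subgroups such that OFF `S` the base vector `x₀ i` is `L i`-fixed and spans the `L i`-fixed vectors of
`ρ i` (the spherical situation `L i = K i`, `dim Vᵢ^{Kᵢ} = 1`).  Then the vectors of `W` fixed by the BOX SUBGROUP
`∏ L i = boxSubgroup L` (★ `RestrictedProductBoxes`) are exactly the image of `⨂_{i ∈ S} Vᵢ^{Lᵢ}` under the structure map
`⊗ mᵢ ↦ j (extend S m)`, and this map is injective on `⨂_{i ∈ S} Vᵢ^{Lᵢ}`:

* `piTensorProduct_map_injective` — over a field, `PiTensorProduct.map` of injective linear maps is injective (left inverses);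
* `IsRestrictedTensorProductRep.injective_lift_restrictMultilinear_compLinearMap` — the structure map restricted to
  `⨂_{i ∈ S} Nᵢ` (any submodules `Nᵢ ≤ Vᵢ`) is injective for `S ⊇ S₀`;
* `IsRestrictedTensorProductRep.restrictMultilinear_mem_fixedPoints_boxSubgroup` — `j (extend S m)` with `mᵢ ∈ Vᵢ^{Lᵢ}` is
  `∏ L i`-fixed;
* `IsRestrictedTensorProductRep.range_lift_restrictMultilinear_fixedPoints_eq` — the range of the restricted structure map IS
  `W^{∏ L i}` (the tensor-invariants lemma ★ `RestrictedTensorProductAux.mem_span_of_forall_fixed` at a large finite level `S' ⊇ S`,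
  then the spherical slots `i ∈ S' ∖ S` are scalar multiples of `x₀ i` and are absorbed, `MultilinearMap.map_smul_univ`);
* `IsRestrictedTensorProductRep.exists_boxFixedPointsEquiv` — hence a linear isomorphism
  `e : (⨂[k] i : S, Vᵢ^{Lᵢ}) ≃ₗ[k] W^{∏ L i}` with `e (⊗ mᵢ) = j (extend S m)`, and `W^{∏ L i}` is finite-dimensional when the
  `Vᵢ^{Lᵢ}` (`i ∈ S`) are.

This is the level-`K_S' × K^S` bookkeeping of [Flath1979 §2 Example 2] ∕ [Bump1997 §3.3 p. 294, Prop. 3.4.9] («`π^{K} = ⊗_{v ∈ S} π_v^{K_v} ⊗ ⊗_{v ∉ S} ξ_v⁰`»),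
as used in the trace product formula `tr π(⊗ f_v) = ∏ tr π_v(f_v)` (road «TF» of cell `hodgecm-mathlib`, bricks (P2)–(P4)).
Theorems only (the isomorphism is delivered as an `∃`, no `def`); no instance, no notation, no `sorry`.

## References
* D. Flath, *Decomposition of representations into tensor products*, Corvallis 1979, part 1, 179–183, §2 Example 2 [Flath1979].
* D. Bump, *Automorphic Forms and Representations* (1997), §3.3 p. 294, §3.4 Prop. 3.4.9, Thm. 3.4.4 [Bump1997].
-/

open scoped RestrictedProduct TensorProduct
open Filter PiTensorProduct

namespace Literature.NumberTheory.Automorphic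

universe u uk uG v w

/-! ### `PiTensorProduct.map` of injective maps over a field -/

section MapInjective

variable {κ : Type u} {k : Type uk} [Field k] {M N : κ → Type v} [∀ i, AddCommGroup (M i)] [∀ i, Module k (M i)]
  [∀ i, AddCommGroup (N i)] [∀ i, Module k (N i)]

/-- **Over a field, the tensor product of injective linear maps is injective** (each factor has a linear left inverse, and
`PiTensorProduct.map` is functorial). [cite: Bump1997, §3.3 p. 294] -/
theorem piTensorProduct_map_injective (f : ∀ i, M i →ₗ[k] N i) (hf : ∀ i, Function.Injective (f i)) :
    Function.Injective (PiTensorProduct.map f) := by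
  classical
  choose g hg using fun i => LinearMap.exists_leftInverse_of_injective (f i) (LinearMap.ker_eq_bot.2 (hf i))
  have hcomp : (PiTensorProduct.map g).comp (PiTensorProduct.map f) = LinearMap.id := by
    rw [← PiTensorProduct.map_comp]
    have : (fun i => (g i).comp (f i)) = fun i => (LinearMap.id : M i →ₗ[k] M i) := funext hg
    rw [this, PiTensorProduct.map_id]
  intro x y hxy
  have := LinearMap.congr_fun hcomp x
  have hy := LinearMap.congr_fun hcomp y
  rw [LinearMap.comp_apply, LinearMap.id_apply] at this hy
  rw [← this, ← hy, hxy]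

/-- **`dim ⨂ᵢ Mᵢ = ∏ᵢ dim Mᵢ`** for finitely many finite-dimensional spaces (count the tensor basis `Basis.piTensorProduct`).
[cite: Bump1997, §3.3 p. 294] -/
theorem finrank_piTensorProduct [Fintype κ] [∀ i, FiniteDimensional k (M i)] :
    Module.finrank k (⨂[k] i, M i) = ∏ i, Module.finrank k (M i) := by
  classical
  let b : ∀ i, Module.Basis (Fin (Module.finrank k (M i))) k (M i) := fun i => Module.finBasis k (M i)
  rw [Module.finrank_eq_card_basis (Basis.piTensorProduct b), Fintype.card_pi]
  simp only [Fintype.card_fin]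

end MapInjective

section Field

variable {ι : Type u} {k : Type uk} [Field k] {G : ι → Type uG} [∀ i, Group (G i)]
  {K : ∀ i, Subgroup (G i)} {V : ι → Type v} [∀ i, AddCommGroup (V i)] [∀ i, Module k (V i)]
  {ρ : ∀ i, Representation k (G i) (V i)} {x₀ : ∀ i, V i} [DecidableEq ι]
  {W : Type w} [AddCommGroup W] [Module k W] {π : Representation k (Πʳ i, [G i, K i]) W}
  {hx₀ : ∀ᶠ i in cofinite, x₀ i ∈ (ρ i).fixedPoints (K i)}
  {j : RestrictedFamily V x₀ → W} {S₀ : Finset ι}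

namespace IsRestrictedTensorProductRep

/-! ### Injectivity of the structure map on `⨂_{i ∈ S} Nᵢ` -/

/-- The structure map restricted to submodules `Nᵢ ≤ Vᵢ` factors as `liftFinset S ∘ ⊗ᵢ (Nᵢ ↪ Vᵢ)`. [cite: Flath1979, §2 Example 2] -/
theorem lift_restrictMultilinear_compLinearMap_eq (h : IsRestrictedTensorProductRep ρ π hx₀ j S₀) (S : Finset ι)
    (N : ∀ i, Submodule k (V i)) :
    PiTensorProduct.lift ((h.isRestrictedTensorProduct.isRestrictedMultilinear.restrictMultilinear S).compLinearMap
        fun i : S => (N i).subtype) =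
      (h.isRestrictedTensorProduct.isRestrictedMultilinear.liftFinset S).comp
        (PiTensorProduct.map fun i : S => (N i).subtype) := by
  rw [IsRestrictedMultilinear.liftFinset, PiTensorProduct.lift_comp_map]

/-- **The structure map is injective on `⨂_{i ∈ S} Nᵢ`** for every finite `S ⊇ S₀` and all submodules `Nᵢ ≤ Vᵢ`
(injectivity of `liftFinset S` in a restricted tensor product, and of `⊗ᵢ (Nᵢ ↪ Vᵢ)` over a field).
[cite: Flath1979, §2 Example 2] [cite: Bump1997, §3.3 p. 294] -/
theorem injective_lift_restrictMultilinear_compLinearMap (h : IsRestrictedTensorProductRep ρ π hx₀ j S₀)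
    {S : Finset ι} (hS : S₀ ⊆ S) (N : ∀ i, Submodule k (V i)) :
    Function.Injective (PiTensorProduct.lift
      ((h.isRestrictedTensorProduct.isRestrictedMultilinear.restrictMultilinear S).compLinearMap
        fun i : S => (N i).subtype)) := by
  rw [h.lift_restrictMultilinear_compLinearMap_eq S N, LinearMap.coe_comp]
  exact (h.isRestrictedTensorProduct.injective_liftFinset hS).comp
    (piTensorProduct_map_injective _ fun i => Subtype.val_injective)

/-! ### The values `j (extend S m)`, `mᵢ ∈ Vᵢ^{Lᵢ}`, are `∏ L i`-fixed -/

/-- **`j (extend S m)` is fixed by the box subgroup `∏ L i`** when `mᵢ ∈ Vᵢ^{Lᵢ}` for `i ∈ S` and the base vectors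
`x₀ i` (`i ∉ S`) are `L i`-fixed (equivariance of `j` and the coordinatewise action). [cite: Flath1979, §2 Example 2] -/
theorem restrictMultilinear_mem_fixedPoints_boxSubgroup (h : IsRestrictedTensorProductRep ρ π hx₀ j S₀) (S : Finset ι)
    (L : ∀ i, Subgroup (G i)) (hx₀L : ∀ i, i ∉ S → x₀ i ∈ (ρ i).fixedPoints (L i))
    (m : ∀ i : S, V i) (hm : ∀ i : S, m i ∈ (ρ i).fixedPoints (L i)) :
    h.isRestrictedTensorProduct.isRestrictedMultilinear.restrictMultilinear S m ∈
      π.fixedPoints (boxSubgroup (K := K) L) := by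
  rw [Representation.mem_fixedPoints]
  intro g hg
  rw [IsRestrictedMultilinear.restrictMultilinear_apply, ← h.map_smul]
  congr 1
  ext i
  rw [RestrictedFamily.smul_apply]
  by_cases hi : i ∈ S
  · rw [RestrictedFamily.extend_apply_of_mem _ _ hi]
    exact ((ρ i).mem_fixedPoints (L i) _).1 (hm ⟨i, hi⟩) (g i) (hg i)
  · rw [RestrictedFamily.extend_apply_of_notMem _ _ hi]
    exact ((ρ i).mem_fixedPoints (L i) _).1 (hx₀L i hi) (g i) (hg i)

/-- The range of the restricted structure map lies in the box-level invariants. [cite: Flath1979, §2 Example 2] -/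
theorem range_lift_restrictMultilinear_fixedPoints_le (h : IsRestrictedTensorProductRep ρ π hx₀ j S₀) (S : Finset ι)
    (L : ∀ i, Subgroup (G i)) (hx₀L : ∀ i, i ∉ S → x₀ i ∈ (ρ i).fixedPoints (L i)) :
    LinearMap.range (PiTensorProduct.lift
      ((h.isRestrictedTensorProduct.isRestrictedMultilinear.restrictMultilinear S).compLinearMap
        fun i : S => ((ρ i).fixedPoints (L i)).subtype)) ≤ π.fixedPoints (boxSubgroup (K := K) L) := by
  rw [LinearMap.range_eq_map, ← PiTensorProduct.span_tprod_eq_top, Submodule.map_span, Submodule.span_le]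
  rintro _ ⟨_, ⟨m, rfl⟩, rfl⟩
  rw [SetLike.mem_coe, PiTensorProduct.lift.tprod, MultilinearMap.compLinearMap_apply]
  exact h.restrictMultilinear_mem_fixedPoints_boxSubgroup S L hx₀L _ fun i => (m i).2

/-! ### Every `∏ L i`-fixed vector comes from `⨂_{i ∈ S} Vᵢ^{Lᵢ}` -/

/-- **Box-invariants at a large level**: a `∏ L i`-fixed `w` lying in the range of `liftFinset S'` is a linear combination of
values `j (extend S' m)` with EVERY slot `mᵢ ∈ Vᵢ^{Lᵢ}` (`i ∈ S'`) — the tensor-invariants lemma ★ `mem_span_of_forall_fixed`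
with the slot operators `π (ι_i g)`, `g ∈ L i`. [cite: Flath1979, §2 Example 2] [cite: Bump1997, §3.3 p. 294] -/
theorem mem_span_restrictMultilinear_fixedPoints_of_mem_fixedPoints_boxSubgroup
    (h : IsRestrictedTensorProductRep ρ π hx₀ j S₀) {S' : Finset ι} (hS' : S₀ ⊆ S') (L : ∀ i, Subgroup (G i)) {w : W}
    (hw : w ∈ π.fixedPoints (boxSubgroup (K := K) L))
    (hwS' : w ∈ LinearMap.range (h.isRestrictedTensorProduct.isRestrictedMultilinear.liftFinset S')) :
    w ∈ Submodule.span k (Set.range fun m : (∀ i : S', ↥((ρ i).fixedPoints (L i))) =>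
      h.isRestrictedTensorProduct.isRestrictedMultilinear.restrictMultilinear S' fun i => (m i : V i)) := by
  classical
  have hj := h.isRestrictedTensorProduct.isRestrictedMultilinear
  refine RestrictedTensorProductAux.mem_span_of_forall_fixed (hj.restrictMultilinear S')
    (h.isRestrictedTensorProduct.injective_liftFinset hS')
    (fun i : S' => Set.range fun g : L (i : ι) => ((ρ i) (g : G i) : V i →ₗ[k] V i))
    (fun i : S' => (ρ i).fixedPoints (L i)) (fun i x hx => ?_) w hwS' (fun i e he => ?_)
  · rw [Representation.mem_fixedPoints]
    intro g hg
    exact hx _ ⟨⟨g, hg⟩, rfl⟩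
  · obtain ⟨g, rfl⟩ := he
    refine ⟨π (RestrictedProduct.mulSingle K (i : ι) (g : G i)), fun m => h.apply_mulSingle_restrictMultilinear S' i _ m, ?_⟩
    rw [Representation.mem_fixedPoints] at hw
    exact hw _ (mulSingle_mem_boxSubgroup_iff.2 g.2)

/-- **Absorbing the spherical slots**: if off `S` the `L i`-fixed vectors of `ρ i` are the multiples of `x₀ i`, then for `S ⊆ S'`
every value `j (extend S' m)` with all `mᵢ ∈ Vᵢ^{Lᵢ}` (`i ∈ S'`) already lies in the range of the restricted structure map at
level `S` (the slots `i ∈ S' ∖ S` contribute the scalar `∏ cᵢ`, `mᵢ = cᵢ • x₀ i`; `MultilinearMap.map_smul_univ`).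
[cite: Flath1979, §2 Example 2] [cite: Bump1997, §3.3 p. 294] -/
theorem restrictMultilinear_mem_range_lift_of_subset (h : IsRestrictedTensorProductRep ρ π hx₀ j S₀) {S S' : Finset ι}
    (hSS' : S ⊆ S') (L : ∀ i, Subgroup (G i))
    (hsph : ∀ i, i ∉ S → ∀ v ∈ (ρ i).fixedPoints (L i), v ∈ k ∙ x₀ i)
    (m : ∀ i : S', V i) (hm : ∀ i : S', m i ∈ (ρ i).fixedPoints (L i)) :
    h.isRestrictedTensorProduct.isRestrictedMultilinear.restrictMultilinear S' m ∈
      LinearMap.range (PiTensorProduct.lift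
        ((h.isRestrictedTensorProduct.isRestrictedMultilinear.restrictMultilinear S).compLinearMap
          fun i : S => ((ρ i).fixedPoints (L i)).subtype)) := by
  classical
  have hj := h.isRestrictedTensorProduct.isRestrictedMultilinear
  -- the scalars at the slots `i ∈ S' ∖ S`
  have hc : ∀ i : S', (i : ι) ∉ S → ∃ c : k, c • x₀ i = m i := fun i hi =>
    Submodule.mem_span_singleton.1 (hsph i hi (m i) (hm i))
  choose c hc using hc
  -- split `m = c' • m0` slotwise
  let c' : S' → k := fun i => if hi : (i : ι) ∈ S then 1 else c i hi
  let m0 : ∀ i : S', V i := fun i => if hi : (i : ι) ∈ S then m i else x₀ i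
  have hsplit : m = fun i => c' i • m0 i := by
    funext i
    by_cases hi : (i : ι) ∈ S
    · simp only [c', m0, hi, ↓reduceDIte, one_smul]
    · simp only [c', m0, hi, ↓reduceDIte, hc i hi]
  -- the base family off `S`: `extend S' m0 = extend S (m|S)`
  let mS : ∀ i : S, ↥((ρ i).fixedPoints (L i)) := fun i => ⟨m ⟨i, hSS' i.2⟩, hm ⟨i, hSS' i.2⟩⟩
  have hext : RestrictedFamily.extend (x₀ := x₀) S' m0 = RestrictedFamily.extend S fun i : S => (mS i : V i) := by
    ext l
    by_cases hl : l ∈ S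
    · rw [RestrictedFamily.extend_apply_of_mem _ _ (hSS' hl), RestrictedFamily.extend_apply_of_mem _ _ hl]
      simp only [m0, hl, ↓reduceDIte, mS]
    · rw [RestrictedFamily.extend_apply_of_notMem _ _ hl]
      by_cases hl' : l ∈ S'
      · rw [RestrictedFamily.extend_apply_of_mem _ _ hl']
        simp only [m0, hl, ↓reduceDIte]
      · rw [RestrictedFamily.extend_apply_of_notMem _ _ hl']
  rw [hsplit, MultilinearMap.map_smul_univ, IsRestrictedMultilinear.restrictMultilinear_apply, hext]
  refine Submodule.smul_mem _ _ ⟨tprod k mS, ?_⟩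
  rw [PiTensorProduct.lift.tprod, MultilinearMap.compLinearMap_apply, IsRestrictedMultilinear.restrictMultilinear_apply]
  rfl

/-- **The box-level invariants are the image of `⨂_{i ∈ S} Vᵢ^{Lᵢ}`**: for `S ⊇ S₀`, `L i`-fixed base vectors off `S` spanning
the `L i`-fixed lines, `range (⊗ mᵢ ↦ j (extend S m) on ⨂_{i∈S} Vᵢ^{Lᵢ}) = W^{∏ L i}`.  («`π^{K_S'·K^S} = ⊗_{v ∈ S} π_v^{K_v} ⊗
⊗_{v ∉ S} ℂ ξ_v⁰`».) [cite: Flath1979, §2 Example 2] [cite: Bump1997, §3.3 p. 294; Prop. 3.4.9] -/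
theorem range_lift_restrictMultilinear_fixedPoints_eq (h : IsRestrictedTensorProductRep ρ π hx₀ j S₀) {S : Finset ι}
    (hS : S₀ ⊆ S) (L : ∀ i, Subgroup (G i)) (hx₀L : ∀ i, i ∉ S → x₀ i ∈ (ρ i).fixedPoints (L i))
    (hsph : ∀ i, i ∉ S → ∀ v ∈ (ρ i).fixedPoints (L i), v ∈ k ∙ x₀ i) :
    LinearMap.range (PiTensorProduct.lift
      ((h.isRestrictedTensorProduct.isRestrictedMultilinear.restrictMultilinear S).compLinearMap
        fun i : S => ((ρ i).fixedPoints (L i)).subtype)) = π.fixedPoints (boxSubgroup (K := K) L) := by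
  classical
  refine le_antisymm (h.range_lift_restrictMultilinear_fixedPoints_le S L hx₀L) fun w hw => ?_
  -- `w` comes from a finite level `S' ⊇ S`
  obtain ⟨S', hSS', hwS'⟩ := h.isRestrictedTensorProduct.exists_mem_range_liftFinset S w
  have hspan := h.mem_span_restrictMultilinear_fixedPoints_of_mem_fixedPoints_boxSubgroup (hS.trans hSS') L hw hwS'
  refine (Submodule.span_le.2 ?_) hspan
  rintro _ ⟨m, rfl⟩
  exact h.restrictMultilinear_mem_range_lift_of_subset hSS' L hsph (fun i => (m i : V i)) fun i => (m i).2

/-! ### The linear isomorphism `⨂_{i ∈ S} Vᵢ^{Lᵢ} ≃ W^{∏ L i}` and finite-dimensionality -/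

/-- **`(⊗'ᵢ Vᵢ)^{∏ Lᵢ} ≅ ⨂_{i ∈ S} Vᵢ^{Lᵢ}`**: for `S ⊇ S₀` and `L i`-fixed base vectors off `S` spanning the `L i`-fixed lines
there is a linear isomorphism `e : (⨂[k] i : S, Vᵢ^{Lᵢ}) ≃ₗ[k] W^{∏ L i}` with `e (⊗ mᵢ) = j (extend S m)`.
[cite: Flath1979, §2 Example 2] [cite: Bump1997, §3.3 p. 294; Prop. 3.4.9] -/
theorem exists_boxFixedPointsEquiv (h : IsRestrictedTensorProductRep ρ π hx₀ j S₀) {S : Finset ι} (hS : S₀ ⊆ S)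
    (L : ∀ i, Subgroup (G i)) (hx₀L : ∀ i, i ∉ S → x₀ i ∈ (ρ i).fixedPoints (L i))
    (hsph : ∀ i, i ∉ S → ∀ v ∈ (ρ i).fixedPoints (L i), v ∈ k ∙ x₀ i) :
    ∃ e : (⨂[k] i : S, ↥((ρ i).fixedPoints (L i))) ≃ₗ[k] ↥(π.fixedPoints (boxSubgroup (K := K) L)),
      ∀ m : ∀ i : S, ↥((ρ i).fixedPoints (L i)),
        (e (tprod k m) : W) =
          h.isRestrictedTensorProduct.isRestrictedMultilinear.restrictMultilinear S fun i => (m i : V i) := by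
  classical
  let Φ := PiTensorProduct.lift
    ((h.isRestrictedTensorProduct.isRestrictedMultilinear.restrictMultilinear S).compLinearMap
      fun i : S => ((ρ i).fixedPoints (L i)).subtype)
  have hrange := h.range_lift_restrictMultilinear_fixedPoints_eq hS L hx₀L hsph
  have hmem : ∀ x, Φ x ∈ π.fixedPoints (boxSubgroup (K := K) L) := fun x => hrange ▸ LinearMap.mem_range_self Φ x
  refine ⟨LinearEquiv.ofBijective (LinearMap.codRestrict _ Φ hmem) ⟨fun x y hxy => ?_, fun y => ?_⟩, fun m => ?_⟩
  · exact h.injective_lift_restrictMultilinear_compLinearMap hS (fun i => (ρ i).fixedPoints (L i))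
      (by exact congrArg Subtype.val hxy)
  · have hy : (y : W) ∈ LinearMap.range Φ := by rw [hrange]; exact y.2
    obtain ⟨x, hx⟩ := hy
    exact ⟨x, Subtype.ext hx⟩
  · rw [LinearEquiv.ofBijective_apply, LinearMap.codRestrict_apply, PiTensorProduct.lift.tprod,
      MultilinearMap.compLinearMap_apply]
    rfl

/-- **`W^{∏ L i}` is finite-dimensional** when the local invariants `Vᵢ^{Lᵢ}`, `i ∈ S`, are (e.g. `ρ i` admissible and `L i`
compact open) — the level-by-level finiteness behind the admissibility of `⊗'ᵢ ρᵢ` [Bump1997 Prop. 3.4.9], with the dimension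
`dim W^{∏ L i} = ∏_{i ∈ S} dim Vᵢ^{Lᵢ}`. [cite: Bump1997, Prop. 3.4.9] [cite: Flath1979, §2 Example 2] -/
theorem finiteDimensional_fixedPoints_boxSubgroup (h : IsRestrictedTensorProductRep ρ π hx₀ j S₀) {S : Finset ι}
    (hS : S₀ ⊆ S) (L : ∀ i, Subgroup (G i)) (hx₀L : ∀ i, i ∉ S → x₀ i ∈ (ρ i).fixedPoints (L i))
    (hsph : ∀ i, i ∉ S → ∀ v ∈ (ρ i).fixedPoints (L i), v ∈ k ∙ x₀ i)
    (hfin : ∀ i : S, FiniteDimensional k ↥((ρ i).fixedPoints (L i))) :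
    FiniteDimensional k ↥(π.fixedPoints (boxSubgroup (K := K) L)) ∧
      Module.finrank k ↥(π.fixedPoints (boxSubgroup (K := K) L)) =
        ∏ i : S, Module.finrank k ↥((ρ i).fixedPoints (L i)) := by
  haveI := hfin
  obtain ⟨e, -⟩ := h.exists_boxFixedPointsEquiv hS L hx₀L hsph
  refine ⟨Module.Finite.equiv e, ?_⟩
  rw [← e.finrank_eq, finrank_piTensorProduct]

end IsRestrictedTensorProductRep

end Field

end Literature.NumberTheory.Automorphic
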